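import Summits.QuantumFields.YangMills.Theorems.UnitScaleTiltProp8EulerLagrangeCarrier
import Literature.LinearAlgebra.Matrix.UnitaryGroupExpSurjective
import HarnessLib

/-!
# Route `UnitScaleTilt`, crux K1 «MinimiserStabilityRegPr» (stmt-QuantumFields-19200), stub `stub_prop8` (V2) — sub-lemma V2-EL, part 7: the Euler–Lagrange
# equation of R2-critical configurations at the d = 3 carrier ALONG ONE-PARAMETER SUBGROUPS: for every `X ∈ 𝔰𝔲(2)` (skew-Hermitian, trace zero) and every
# non-central fine bond `b₀`, the curve `t ↦ exp(tX)·U₀(b₀)` feeds part 6, so `∃ ξ, ξ(b₀) = X ∧ (ξ = 0 off {b₀} ∪ centralBond) ∧ Lin_{U₀}(ξ) = 0` — the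
# multiplier form of the criticality equation with the velocity prescribed in the Lie algebra, no curve to be supplied by the user.

Cell `ym3-torus` ∕ fleet seat `ym-ust-19200-p2` g3.  [folklore] packaging of part 6 (`exists_tangent_lin_eq_zero_of_isCritR2`) with the exponential chart
(`exp(𝔰𝔲(2)) ⊆ SU(2)`: `Literature.LinearAlgebra.Matrix.UnitaryGroupExpSurjective.exp_mem_specialUnitaryGroup_of_mem_skewAdjoint`).
WHAT IS PROVED (sorry-free, no definition): `expCurve_mem`, **`exists_lieTangent_lin_eq_zero_of_isCritR2`**.
References: T. Bałaban, CMP 102 (1985) 277–309 [Balaban1985Variational] ((127) p.297, p.300).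
-/

noncomputable section

open scoped BigOperators Matrix.Norms.L2Operator Matrix Topology
open Filter Function NormedSpace

namespace Summit.QuantumFields.YangMills.Theorems.Prop8Criticality

open Literature.MathematicalPhysics.QuantumFieldTheory.Balaban1983to89
open T4Continuum AveragingRT BlockAveraging BlockAveragingHaarAC ExpMeanLog
open T3ContinuumYM3Torus T3PrintedRegularMinimiser T3Thm1CarrierNative
open Summit.QuantumFields.YangMills.Theorems.BlockAvgCorrector (stokesConst)
open BlockAveragingEMLHaarAC (emlWeight)
open Literature.LinearAlgebra.Matrix (exp_mem_specialUnitaryGroup_of_mem_skewAdjoint)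

/-- The one-parameter subgroup through a special unitary: `exp(tX)·g ∈ SU(2)` for `X` skew-Hermitian of trace zero and real `t`. [folklore] -/
theorem expCurve_mem {X : Matrix (Fin 2) (Fin 2) ℂ} (hX : X ∈ skewAdjoint (Matrix (Fin 2) (Fin 2) ℂ)) (htr : X.trace = 0)
    (g : Matrix.specialUnitaryGroup (Fin 2) ℂ) (t : ℝ) :
    exp (t • X) * (g : Matrix (Fin 2) (Fin 2) ℂ) ∈ Matrix.specialUnitaryGroup (Fin 2) ℂ := by
  have h1 : exp (t • X) ∈ Matrix.specialUnitaryGroup (Fin 2) ℂ :=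
    exp_mem_specialUnitaryGroup_of_mem_skewAdjoint (skewAdjoint.smul_mem t hX) (by rw [Matrix.trace_smul, htr, smul_zero])
  exact Submonoid.mul_mem _ h1 g.2

/-- **THE EULER–LAGRANGE EQUATION OF AN R2-CRITICAL CONFIGURATION AT THE d = 3 CARRIER, ALONG `𝔰𝔲(2)`**: under the hypotheses of
`exists_tangent_lin_eq_zero_of_isCritR2`, for every `X ∈ 𝔰𝔲(2)` and every non-central fine bond `b₀` there is a bond field `ξ` with `ξ(b₀) = X`, `ξ = 0` at
every other non-central bond, and `Lin_{U₀}(ξ) = 0`. [cite: Balaban1985Variational, (127) p.297] -/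
theorem exists_lieTangent_lin_eq_zero_of_isCritR2 (F : T3Family) {n K : ℕ} (hnK : n ≤ K)
    {V : GaugeField (F.P n) 0 (Matrix.specialUnitaryGroup (Fin 2) ℂ)} {U₀ : GaugeField (F.P (K + 1)) 0 (Matrix.specialUnitaryGroup (Fin 2) ℂ)}
    (hcrit : IsCritR2 F n (K + 1) (hnK.trans (Nat.le_succ K)) V U₀)
    {t₀ : ℝ} (ht₀ : 0 < t₀) (hsmall : stokesConst (F.P (K + 1)) * t₀ ≤ emlWeight (F.P (K + 1)) / 1000) (hU₀ : PlaqSmall t₀ U₀)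
    (b₀ : PBond (F.P (K + 1)) 0) (hb₀ : ∀ c : PBond (F.P (K + 1)) 1, centralBond c ≠ b₀)
    {X : Matrix (Fin 2) (Fin 2) ℂ} (hX : X ∈ skewAdjoint (Matrix (Fin 2) (Fin 2) ℂ)) (htr : X.trace = 0) :
    ∃ ξ : PBond (F.P (K + 1)) 0 → Matrix (Fin 2) (Fin 2) ℂ,
      ξ b₀ = X ∧
      (∀ b : PBond (F.P (K + 1)) 0, b ≠ b₀ → (∀ c : PBond (F.P (K + 1)) 1, centralBond c ≠ b) → ξ b = 0) ∧
      ∑ p : Plaq (F.P (K + 1)) 0, (1 / 2) * ((((((GaugeField.plaqHol U₀ p : Matrix.specialUnitaryGroup (Fin 2) ℂ) : Matrix (Fin 2) (Fin 2) ℂ)) - 1)ᴴ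
          * ((ξ ⟨p.src, p.μ⟩
              + (U₀ ⟨p.src, p.μ⟩ : Matrix (Fin 2) (Fin 2) ℂ) * ξ ⟨p.src.shift p.μ, p.ν⟩ * star (U₀ ⟨p.src, p.μ⟩ : Matrix (Fin 2) (Fin 2) ℂ)
              - ((U₀ ⟨p.src, p.μ⟩ * U₀ ⟨p.src.shift p.μ, p.ν⟩ * (U₀ ⟨p.src.shift p.ν, p.μ⟩)⁻¹ : Matrix.specialUnitaryGroup (Fin 2) ℂ) : Matrix (Fin 2) (Fin 2) ℂ)
                  * ξ ⟨p.src.shift p.ν, p.μ⟩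
                  * star ((U₀ ⟨p.src, p.μ⟩ * U₀ ⟨p.src.shift p.μ, p.ν⟩ * (U₀ ⟨p.src.shift p.ν, p.μ⟩)⁻¹ : Matrix.specialUnitaryGroup (Fin 2) ℂ) : Matrix (Fin 2) (Fin 2) ℂ)
              - ((GaugeField.plaqHol U₀ p : Matrix.specialUnitaryGroup (Fin 2) ℂ) : Matrix (Fin 2) (Fin 2) ℂ) * ξ ⟨p.src, p.ν⟩
                  * star ((GaugeField.plaqHol U₀ p : Matrix.specialUnitaryGroup (Fin 2) ℂ) : Matrix (Fin 2) (Fin 2) ℂ))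
            * ((GaugeField.plaqHol U₀ p : Matrix.specialUnitaryGroup (Fin 2) ℂ) : Matrix (Fin 2) (Fin 2) ℂ))).trace).re = 0 := by
  -- the exponential curve through `U₀(b₀)` with velocity `X·U₀(b₀)`
  set g : ℝ → Matrix.specialUnitaryGroup (Fin 2) ℂ := fun t => ⟨exp (t • X) * (U₀ b₀ : Matrix (Fin 2) (Fin 2) ℂ), expCurve_mem hX htr (U₀ b₀) t⟩ with hgdef
  have hg0 : g 0 = U₀ b₀ := by
    apply Subtype.ext
    show exp ((0 : ℝ) • X) * (U₀ b₀ : Matrix (Fin 2) (Fin 2) ℂ) = (U₀ b₀ : Matrix (Fin 2) (Fin 2) ℂ)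
    rw [zero_smul, exp_zero, one_mul]
  have hg : HasDerivAt (fun t : ℝ => (g t : Matrix (Fin 2) (Fin 2) ℂ)) (X * (U₀ b₀ : Matrix (Fin 2) (Fin 2) ℂ)) 0 := by
    have h1 := (hasDerivAt_exp_smul_const' X (0 : ℝ)).mul_const (U₀ b₀ : Matrix (Fin 2) (Fin 2) ℂ)
    simp only [zero_smul, exp_zero, mul_one] at h1
    exact h1
  obtain ⟨ξ, hξ₀, hξoff, hmain⟩ := exists_tangent_lin_eq_zero_of_isCritR2 F hnK hcrit ht₀ hsmall hU₀ b₀ hb₀ g hg0 hg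
  refine ⟨ξ, ?_, hξoff, hmain⟩
  rw [hξ₀, mul_assoc, Matrix.mem_unitaryGroup_iff.mp (U₀ b₀).2.1, mul_one]

end Summit.QuantumFields.YangMills.Theorems.Prop8Criticality

end
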